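import Summits.NavierStokesRegularity.FluidComputer.ClayBlowupSingularSliceAxis
import Summits.NavierStokesRegularity.FluidComputer.DesignedBlowupFarField
import HarnessLib

/-!
# UNIFORM BOUNDS UP TO THE BLOW-UP TIME AWAY FROM THE SINGULAR SLICE: a Clay blow-up is bounded on
# `[δ, T) × K` for every compact `K` missing its singular slice; an axisymmetric one is bounded up to
# `T` outside every tube around the axis

Cell `ns-blowup`, seat `ns-blowup-ecbridge-2` (g7; the E–C endpoint theory seat). LABEL: E–C typing
(KERNEL — no named fact). WHAT THIS IS NOT: not Navier–Stokes evidence — necessary conditions on the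
TYPES `ClayBlowup ν` / `DesignedBlowup ν` (no inhabitant is claimed). Companion memo:
`run/shared/lean/pub/ns-blowup/ecbridge2/ECBRIDGE-2-MEMO-6.md` §2 (row R6-axis).

## Content

Backward boundedness is a pointwise-in-`x₀` notion (one backward cylinder per point). Compactness in
space–time turns it into UNIFORM bounds up to the blow-up time (the compactness argument of the tree's
`SereginSverak2002.nearField_bound`, run over an arbitrary compact spatial set):

* `ClayBlowup.exists_bound_on_compact_of_isBackwardBoundedAt` — if every point of a compact `K ⊆ ℝ³`
  is backward bounded at `T`, then `u` is bounded on `[δ, T) × K` for every `0 < δ < T`;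
* `ClayBlowup.exists_bound_off_singularSlice` — `u` is bounded on `[δ, T) × (K \ 𝒩)`... stated as:
  for every compact `K` DISJOINT from the singular slice `S_T`, `u` is bounded on `[δ, T) × K`
  (together with the far-field bound: the blow-up is confined, uniformly up to `T`, to every
  neighbourhood of the compact ℋ¹-null set `S_T`);
* **`ClayBlowup.exists_bound_off_axis_tube`** — for a Clay blow-up with AXISYMMETRIC datum and force
  (swirl allowed) and every `ρ₀ > 0`, `0 < δ < T`: `u` is bounded on
  `[δ, T) × {x | ρ₀ ≤ cylRadius x}` — UNIFORMLY UP TO THE BLOW-UP TIME OUTSIDE EVERY TUBE AROUND THE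
  AXIS (near field: `singularSlice_subset_axis` + compactness; far field: `exists_farField_bound`);
  the `DesignedBlowup` twin.

References: G. Seregin, V. Šverák, Comm. PDE 34 (2009) = arXiv:0804.1803, §3 [cite: SereginSverak2009, §3];
L. Caffarelli, R. Kohn, L. Nirenberg, CPAM 35 (1982), Theorem B, §6 [cite: CaffarelliKohnNirenberg1982, Theorem B];
L. Escauriaza, G. Seregin, V. Šverák, Russ. Math. Surveys 58 (2003), §3 (3.5)–(3.6)
[cite: EscauriazaSereginSverak2003, §3].
-/

noncomputable section

namespace Summit.NavierStokesRegularity.FluidComputer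

open Set MeasureTheory Filter Topology Function TopologicalSpace Metric
open scoped ENNReal NNReal
open Literature.Analysis.FluidPDE
open Summit.NavierStokesRegularity.NavierStokesRegularity
open Summit.NavierStokesRegularity.FluidComputer.PalasekTowerClayBridge

namespace ClayBlowup

variable {ν : ℝ} (X : ClayBlowup ν)

/-! ## §1 Compact sets of backward bounded points carry uniform bounds up to `T` -/

/-- **Uniform bound up to the blow-up time on a compact set of backward bounded points**: if every
point of a compact `K ⊆ ℝ³` is backward bounded at `T`, then for every `0 < δ < T` there is `M` with
`‖u(t, x)‖ ≤ M` for `δ ≤ t < T`, `x ∈ K` (compactness of `[δ, T] × K`: interior times by continuity,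
the final time by the backward cylinders; the argument of `SereginSverak2002.nearField_bound`).
[cite: EscauriazaSereginSverak2003, §3 (3.5)–(3.6)] -/
theorem exists_bound_on_compact_of_isBackwardBoundedAt {K : Set (EuclideanSpace ℝ (Fin 3))}
    (hK : IsCompact K) (hKbb : ∀ x ∈ K, IsBackwardBoundedAt X.u X.T x) {δ : ℝ} (hδ : 0 < δ) :
    ∃ M : ℝ, ∀ t ∈ Ico δ X.T, ∀ x ∈ K, ‖X.u t x‖ ≤ M := by
  have hT := X.T_pos
  have hu : ContinuousOn (uncurry X.u) (Ico 0 X.T ×ˢ (univ : Set (EuclideanSpace ℝ (Fin 3)))) :=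
    X.classical.smooth_velocity.continuousOn
  set L : Set (ℝ × EuclideanSpace ℝ (Fin 3)) := Icc δ X.T ×ˢ K with hL
  have hLc : IsCompact L := isCompact_Icc.prod hK
  suffices h : ∃ M : ℝ, ∀ z ∈ L, z.1 < X.T → ‖X.u z.1 z.2‖ ≤ M by
    obtain ⟨M, hM⟩ := h
    exact ⟨M, fun t ht x hx => hM (t, x) ⟨⟨ht.1, ht.2.le⟩, hx⟩ ht.2⟩
  refine hLc.induction_on (p := fun A => ∃ M : ℝ, ∀ z ∈ A, z.1 < X.T → ‖X.u z.1 z.2‖ ≤ M)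
    ?_ ?_ ?_ ?_
  · exact ⟨0, fun z hz => hz.elim⟩
  · rintro A B hAB ⟨M, hM⟩
    exact ⟨M, fun z hz => hM z (hAB hz)⟩
  · rintro A B ⟨M, hM⟩ ⟨M', hM'⟩
    refine ⟨max M M', ?_⟩
    rintro z (hA | hB) hzT
    · exact (hM z hA hzT).trans (le_max_left _ _)
    · exact (hM' z hB hzT).trans (le_max_right _ _)
  · rintro ⟨t₀, x₀⟩ ⟨⟨ht₀δ, ht₀T⟩, hx₀K⟩
    have ht₀ : 0 < t₀ := hδ.trans_le ht₀δ
    rcases lt_or_eq_of_le ht₀T with hlt | heq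
    · -- interior time: a compact box inside `[0, T) × ℝ³`
      set B : Set (ℝ × EuclideanSpace ℝ (Fin 3)) :=
        Icc (t₀ / 2) ((t₀ + X.T) / 2) ×ˢ closedBall x₀ 1 with hB
      have hBc : IsCompact B := isCompact_Icc.prod (isCompact_closedBall _ _)
      have hBsub : B ⊆ Ico 0 X.T ×ˢ (univ : Set (EuclideanSpace ℝ (Fin 3))) := by
        rintro ⟨t, x⟩ ⟨⟨ht1, ht2⟩, -⟩
        exact ⟨⟨by linarith, by linarith⟩, mem_univ _⟩
      obtain ⟨M, hM⟩ := hBc.exists_bound_of_continuousOn (hu.mono hBsub)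
      set U : Set (ℝ × EuclideanSpace ℝ (Fin 3)) :=
        Ioo (t₀ / 2) ((t₀ + X.T) / 2) ×ˢ ball x₀ 1 with hU
      have hUo : IsOpen U := isOpen_Ioo.prod isOpen_ball
      have hzU : ((t₀, x₀) : ℝ × EuclideanSpace ℝ (Fin 3)) ∈ U :=
        ⟨⟨by linarith, by linarith⟩, mem_ball_self one_pos⟩
      refine ⟨U, mem_nhdsWithin_of_mem_nhds (hUo.mem_nhds hzU), M, fun z hz _ => ?_⟩
      exact hM z ⟨⟨hz.1.1.le, hz.1.2.le⟩, ball_subset_closedBall hz.2⟩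
    · -- final time: the backward cylinder at `x₀ ∈ K`
      obtain ⟨r, hr, C, hC⟩ := hKbb x₀ hx₀K
      set U : Set (ℝ × EuclideanSpace ℝ (Fin 3)) := Ioo (t₀ - r ^ 2) (t₀ + 1) ×ˢ ball x₀ r with hU
      have hUo : IsOpen U := isOpen_Ioo.prod isOpen_ball
      have hzU : ((t₀, x₀) : ℝ × EuclideanSpace ℝ (Fin 3)) ∈ U :=
        ⟨⟨by nlinarith, by linarith⟩, mem_ball_self hr⟩
      refine ⟨U, mem_nhdsWithin_of_mem_nhds (hUo.mem_nhds hzU), C, fun z hz hzT => ?_⟩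
      have ht₀T' : t₀ = X.T := heq
      exact hC z.1 ⟨by rw [← ht₀T']; exact hz.1.1, hzT⟩ z.2 hz.2

/-- **Uniform bound up to `T` on every compact set missing the singular slice**: if `K` is compact
and every point of `K` is backward bounded (i.e. `K ∩ S_T = ∅`), then `u` is bounded on `[δ, T) × K`,
`0 < δ`. Together with the far-field bound (`exists_farField_bound`) the blow-up is confined, uniformly
up to `T`, to every neighbourhood of the compact `ℋ¹`-null singular slice. No named fact.
[cite: EscauriazaSereginSverak2003, §3 (3.5)–(3.6)] [cite: CaffarelliKohnNirenberg1982, Theorem B (§6)] -/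
theorem exists_bound_off_singularSlice {K : Set (EuclideanSpace ℝ (Fin 3))} (hK : IsCompact K)
    (hKS : Disjoint K {x₀ : EuclideanSpace ℝ (Fin 3) | ¬ IsBackwardBoundedAt X.u X.T x₀})
    {δ : ℝ} (hδ : 0 < δ) :
    ∃ M : ℝ, ∀ t ∈ Ico δ X.T, ∀ x ∈ K, ‖X.u t x‖ ≤ M := by
  refine X.exists_bound_on_compact_of_isBackwardBoundedAt hK (fun x hx => ?_) hδ
  by_contra h
  exact (Set.disjoint_left.1 hKS hx) h

/-! ## §2 Axisymmetric Clay blow-ups are bounded up to `T` outside every tube around the axis -/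

/-- The closed region outside a tube is closed: `{x | ρ₀ ≤ cylRadius x}`. [folklore] -/
theorem isClosed_le_cylRadius (ρ₀ : ℝ) :
    IsClosed {x : EuclideanSpace ℝ (Fin 3) | ρ₀ ≤ cylRadius x} :=
  isClosed_le continuous_const (by
    unfold cylRadius
    fun_prop)

/-- **AN AXISYMMETRIC CLAY BLOW-UP IS BOUNDED UP TO THE BLOW-UP TIME OUTSIDE EVERY TUBE AROUND THE
AXIS**: for a Clay blow-up at `ν > 0` with axisymmetric datum and force (swirl allowed), every tube
radius `ρ₀ > 0` and every `0 < δ`: there is `M` with `‖u(t, x)‖ ≤ M` for all `δ ≤ t < T` and all `x`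
with `cylRadius x ≥ ρ₀`. Near field: the compact set `{ρ₀ ≤ cylRadius} ∩ B̄(0, R)` misses the singular
slice (`singularSlice_subset_axis`), so `exists_bound_on_compact_of_isBackwardBoundedAt` applies; far
field `|x| > R`: `exists_farField_bound_Ico`. The blow-up of an axisymmetric design is confined to the
axis UNIFORMLY in time. No named fact. [cite: SereginSverak2009, §3 (arXiv p. 9)]
[cite: CaffarelliKohnNirenberg1982, Theorem B (§6, p. 807)] -/
theorem exists_bound_off_axis_tube (hν : 0 < ν) (h0A : IsAxisymmetric (X.u 0))
    (hfA : ∀ t ∈ Ico 0 X.T, IsAxisymmetric (X.f t)) {ρ₀ : ℝ} (hρ₀ : 0 < ρ₀) {δ : ℝ} (hδ : 0 < δ) :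
    ∃ M : ℝ, ∀ t ∈ Ico δ X.T, ∀ x : EuclideanSpace ℝ (Fin 3), ρ₀ ≤ cylRadius x → ‖X.u t x‖ ≤ M := by
  have hT := X.T_pos
  -- far field on the whole lifespan
  obtain ⟨R, Mf, hfar⟩ := X.exists_farField_bound_Ico hν
  -- near field: the compact set outside the tube and inside the ball
  set K : Set (EuclideanSpace ℝ (Fin 3)) :=
    {x | ρ₀ ≤ cylRadius x} ∩ closedBall (0 : EuclideanSpace ℝ (Fin 3)) R with hK
  have hKc : IsCompact K :=
    (isCompact_closedBall _ _).of_isClosed_subset ((isClosed_le_cylRadius ρ₀).inter isClosed_closedBall)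
      inter_subset_right
  have hKbb : ∀ x ∈ K, IsBackwardBoundedAt X.u X.T x := fun x hx =>
    X.isBackwardBoundedAt_of_cylRadius_ne_zero hν h0A hfA (by
      have : ρ₀ ≤ cylRadius x := hx.1
      exact ne_of_gt (lt_of_lt_of_le hρ₀ this))
  obtain ⟨Mn, hnear⟩ := X.exists_bound_on_compact_of_isBackwardBoundedAt hKc hKbb hδ
  refine ⟨max Mn Mf, fun t ht x hx => ?_⟩
  rcases le_or_gt ‖x‖ R with hxR | hxR
  · exact (hnear t ht x ⟨hx, mem_closedBall_zero_iff.2 hxR⟩).trans (le_max_left _ _)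
  · exact (hfar t ⟨(le_of_lt hδ).trans ht.1, ht.2⟩ x hxR).trans (le_max_right _ _)

end ClayBlowup

namespace DesignedBlowup

variable {ν : ℝ} (D : DesignedBlowup ν)

/-- **Uniform bound up to `T` on compact sets missing the singular slice**, designed blow-ups
(`toClayBlowup`). [cite: EscauriazaSereginSverak2003, §3 (3.5)–(3.6)] -/
theorem exists_bound_off_singularSlice {K : Set (EuclideanSpace ℝ (Fin 3))} (hK : IsCompact K)
    (hKS : Disjoint K {x₀ : EuclideanSpace ℝ (Fin 3) | ¬ IsBackwardBoundedAt D.u D.T x₀})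
    {δ : ℝ} (hδ : 0 < δ) :
    ∃ M : ℝ, ∀ t ∈ Ico δ D.T, ∀ x ∈ K, ‖D.u t x‖ ≤ M :=
  D.toClayBlowup.exists_bound_off_singularSlice hK hKS hδ

/-- **An axisymmetric designed blow-up is bounded up to the blow-up time outside every tube around
the axis** (`ν > 0`; `toClayBlowup`). [cite: SereginSverak2009, §3 (arXiv p. 9)] -/
theorem exists_bound_off_axis_tube (hν : 0 < ν) (h0A : IsAxisymmetric (D.u 0))
    (hfA : ∀ t ∈ Ico 0 D.T, IsAxisymmetric (D.f t)) {ρ₀ : ℝ} (hρ₀ : 0 < ρ₀) {δ : ℝ} (hδ : 0 < δ) :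
    ∃ M : ℝ, ∀ t ∈ Ico δ D.T, ∀ x : EuclideanSpace ℝ (Fin 3), ρ₀ ≤ cylRadius x → ‖D.u t x‖ ≤ M :=
  D.toClayBlowup.exists_bound_off_axis_tube hν h0A hfA hρ₀ hδ

end DesignedBlowup

/-! ## §3 The blow-up of an axisymmetric Clay blow-up happens inside every tube around the axis -/

namespace ClayBlowup

variable {ν : ℝ} (X : ClayBlowup ν)

/-- **AN AXISYMMETRIC CLAY BLOW-UP BLOWS UP INSIDE EVERY TUBE AROUND THE AXIS, ARBITRARILY CLOSE TO
`T`**: for a Clay blow-up at `ν > 0` with axisymmetric datum and force, every tube radius `ρ₀ > 0`,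
every bound `M` and every `t₀ < T`, there are `t ∈ (t₀, T)` and `x` with `cylRadius x < ρ₀` and
`‖u(t, x)‖ > M` (the velocity is unbounded near `T`, `exists_norm_gt_near`, and bounded off the tube,
`exists_bound_off_axis_tube`). No named fact. [cite: SereginSverak2009, §3 (arXiv p. 9)] -/
theorem unbounded_in_axis_tube (hν : 0 < ν) (h0A : IsAxisymmetric (X.u 0))
    (hfA : ∀ t ∈ Ico 0 X.T, IsAxisymmetric (X.f t)) {ρ₀ : ℝ} (hρ₀ : 0 < ρ₀) (M : ℝ) {t₀ : ℝ}
    (ht₀ : t₀ < X.T) :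
    ∃ t ∈ Ioo t₀ X.T, ∃ x : EuclideanSpace ℝ (Fin 3), cylRadius x < ρ₀ ∧ M < ‖X.u t x‖ := by
  have hT := X.T_pos
  obtain ⟨M₁, h₁⟩ := X.exists_bound_off_axis_tube hν h0A hfA hρ₀ (half_pos hT)
  have ht₁ : max t₀ (X.T / 2) < X.T := max_lt ht₀ (by linarith)
  obtain ⟨t, ht, x, hx⟩ := X.exists_norm_gt_near hν ht₁ (max M M₁)
  refine ⟨t, ⟨(le_max_left _ _).trans_lt ht.1, ht.2⟩, x, ?_, (le_max_left _ _).trans_lt hx⟩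
  by_contra hge
  push Not at hge
  have hb := h₁ t ⟨((le_max_right _ _).trans_lt ht.1).le, ht.2⟩ x hge
  exact absurd hb (not_le.2 ((le_max_right _ _).trans_lt hx))

end ClayBlowup

namespace DesignedBlowup

variable {ν : ℝ} (D : DesignedBlowup ν)

/-- **An axisymmetric designed blow-up blows up inside every tube around the axis, arbitrarily close
to `T`** (`ν > 0`; `toClayBlowup`). [cite: SereginSverak2009, §3 (arXiv p. 9)] -/
theorem unbounded_in_axis_tube (hν : 0 < ν) (h0A : IsAxisymmetric (D.u 0))
    (hfA : ∀ t ∈ Ico 0 D.T, IsAxisymmetric (D.f t)) {ρ₀ : ℝ} (hρ₀ : 0 < ρ₀) (M : ℝ) {t₀ : ℝ}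
    (ht₀ : t₀ < D.T) :
    ∃ t ∈ Ioo t₀ D.T, ∃ x : EuclideanSpace ℝ (Fin 3), cylRadius x < ρ₀ ∧ M < ‖D.u t x‖ :=
  D.toClayBlowup.unbounded_in_axis_tube hν h0A hfA hρ₀ M ht₀

end DesignedBlowup

end Summit.NavierStokesRegularity.FluidComputer

end
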